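import Literature.AlgebraicGeometry.Smoothening.JacobianCriterion
import Literature.AlgebraicGeometry.Smoothening.ConormalLocalization
import Literature.AlgebraicGeometry.Dimension.SmoothRelativeDimensionBound
import Literature.AlgebraicGeometry.Resolution.AffineDomainEquidim
import Literature.AlgebraicGeometry.Resolution.RegularLocalRingsProofs
import Mathlib.RingTheory.KrullDimension.NonZeroDivisors
import HarnessLib

/-!
# The Jacobian criterion for a subvariety of the expected dimension (dimension squeeze)

Topic: `Literature/AlgebraicGeometry/Smoothening`. Companion of `JacobianCriterion.lean`
(`D[1/Δ]` is standard smooth of relative dimension `n - c` over `R`, `D = R[T₁,…,Tₙ]/(f₁,…,f_c)`,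
`Δ` a `c × c` minor of the Jacobian) and `JacobianCriterionCover.lean`. It PROVES the form of the
Jacobian criterion used when the equations `f₁, …, f_c` are only known to VANISH on an integral
closed subscheme `Z = Spec D/𝔞 ⊆ Spec D` of the expected dimension `n - c` — the argument by
which Y. Hu, *Universal characteristic-free resolution of singularities, I* (arXiv:2507.21400),
§8.4, proof of Thm. 8.5, concludes smoothness of the final transform `Ṽ_ℓ` from the rank of the
Jacobian of the governing binomials and linearized Plücker relations alone (the other defining
relations, `𝓑^𝔯𝔟`, being unknown):

> "`dim T_z(Ṽ_ℓ) = dim R̃_ℓ - rk J(z) ≤ dim R̃_ℓ - rk J*(z) = dim 𝕌 + |𝓑^gov| - (|𝓑^gov| + Υ)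
> = dim 𝕌 - Υ = dim Ṽ_ℓ`. Hence `dim T_z(Ṽ_ℓ) = dim Ṽ_ℓ`, thus `Ṽ_ℓ` is smooth at `z`. …
> Consequently, on any preferred admissible affine chart all the relations of `𝓑^𝔯𝔟_𝔙` must lie
> in the ideal generated by relations of `𝓑^gov_𝔙` and `L_{𝓕,𝔙}`, thus can be discarded."

In commutative algebra, over a field `K`: let `𝔞 ⊆ 𝔪` be an ideal and a maximal ideal of
`D = K[T₁,…,Tₙ]/(f₁,…,f_c)` with `D/𝔞` a DOMAIN of Krull dimension `≥ n - c`, and suppose the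
Jacobian minor `Δ` does not lie in `𝔪`. Then

* `Ideal.map_atPrime_eq_bot_of_notMem` — **`𝔞 D_𝔪 = 0`**: near the point `𝔪` the subscheme
  `Spec D/𝔞` IS the complete intersection `Spec D` (Hu: the extra relations "can be discarded");
* `isRegularLocalRing_atPrime_quotient_of_notMem` — **`(D/𝔞)_𝔪` is a regular local ring**
  (Hu: "`Ṽ_ℓ` is smooth at `z`"), and `ringKrullDim_quotient_eq_of_notMem` — `dim D/𝔞 = d`
  exactly;
* the same three for a surjection `π : D ↠ B` onto a domain (`RingHom.ker_map_atPrime_eq_bot_of_notMem`,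
  `isRegularLocalRing_atPrime_of_surjective_of_notMem`, `ringKrullDim_eq_of_surjective_of_notMem`).

Everything is first proved for an arbitrary `K`-algebra `D` of finite type and an element `Δ`
with `D[1/Δ]` standard smooth of relative dimension `d` over `K` (`…_of_notMem`), then
specialised to `D = K[T]/(f)`, `d = n - c` and a Jacobian minor `Δ`
(`…_of_jacobianMinor_notMem`, via `JacobianCriterion.isStandardSmoothOfRelativeDimension_away`),
in the surjection form (which avoids iterated quotient types).

Proof (the printed tangent-space count, made rigorous as a dimension squeeze): `D_𝔪` is a
localization of the standard smooth `D[1/Δ]`, hence a regular local ring — a domain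
(Matsumura 14.3, `isDomain_of_isRegularLocalRing`) — of dimension `≤ n - c`
(`height_le_of_isStandardSmoothOfRelativeDimension_of_isNoetherianRing`,
`isRegularLocalRing_of_isStandardSmoothOfRelativeDimension`); `(D/𝔞)_𝔪 = D_𝔪/𝔞D_𝔪` has
dimension `dim D/𝔞 ≥ n - c` (affine domains are equidimensional at closed points,
`ringKrullDim_localization_atPrime_eq_of_isMaximal`); and a non-zero ideal of a domain of finite
Krull dimension strictly lowers the dimension (`Ideal.eq_bot_of_ringKrullDim_le_quotient`, from
Mathlib's `ringKrullDim_quotient_succ_le_of_nonZeroDivisor`). No named facts (D-0026).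

## References

* Y. Hu, *Universal Characteristic-free Resolution of Singularities, I*, arXiv:2507.21400 (2025),
  §8.4, proof of Thm. 8.5 (theorem numbers of the arXiv v1 TeX source). [Hu2025]
* U. Görtz, T. Wedhorn, *Algebraic Geometry I*, 2nd ed. (2020), Def. 6.14, Lemma 6.26 (smooth
  points are regular of dimension `≤ d`). [GortzWedhorn2020]
* H. Matsumura, *Commutative Ring Theory* (1986), Thm. 14.3 (regular local rings are domains),
  §5 (dimension of affine domains). [Matsumura1987]
-/

noncomputable section

open MvPolynomial IsLocalRing

namespace Literature.AlgebraicGeometry.Smoothening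

universe u

/-! ### The squeeze: a non-zero ideal of a finite-dimensional domain lowers the dimension -/

/-- **Dimension squeeze**: in a domain `R` of finite Krull dimension, an ideal `I` with
`dim R ≤ dim R/I` is zero (a non-zero `x ∈ I` is a non-zero-divisor, and
`dim R/(x) + 1 ≤ dim R`). [folklore] -/
theorem Ideal.eq_bot_of_ringKrullDim_le_quotient {R : Type*} [CommRing R] [IsDomain R]
    [FiniteRingKrullDim R] {I : Ideal R} (h : ringKrullDim R ≤ ringKrullDim (R ⧸ I)) :
    I = ⊥ := by
  by_contra hI
  obtain ⟨x, hxI, hx0⟩ := Submodule.exists_mem_ne_zero_of_ne_bot hI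
  have hle : Ideal.span {x} ≤ I := (Ideal.span_singleton_le_iff_mem _).mpr hxI
  have h1 : ringKrullDim (R ⧸ I) ≤ ringKrullDim (R ⧸ Ideal.span {x}) :=
    ringKrullDim_le_of_surjective (Ideal.Quotient.factor hle) (Ideal.Quotient.factor_surjective hle)
  have h2 : ringKrullDim (R ⧸ Ideal.span {x}) + 1 ≤ ringKrullDim R :=
    ringKrullDim_quotient_succ_le_of_nonZeroDivisor (mem_nonZeroDivisors_of_ne_zero hx0)
  have hne_bot : ringKrullDim R ≠ ⊥ := ringKrullDim_ne_bot
  have hne_top : ringKrullDim R ≠ ⊤ := ringKrullDim_ne_top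
  have h3 : ringKrullDim R + 1 ≤ ringKrullDim R :=
    le_trans (add_le_add (h.trans h1) le_rfl) h2
  revert hne_bot hne_top h3
  generalize ringKrullDim R = d
  intro hne_bot hne_top h3
  induction d using WithBot.recBotCoe with
  | bot => exact hne_bot rfl
  | coe d =>
    induction d using ENat.recTopCoe with
    | top => exact hne_top rfl
    | coe d =>
      have h4 : ((d + 1 : ℕ) : WithBot ℕ∞) ≤ (d : ℕ) := by exact_mod_cast h3
      have h5 : d + 1 ≤ d := by exact_mod_cast h4
      omega

/-! ### Local rings of `D` off `V(Δ)` when `D[1/Δ]` is standard smooth over a field -/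

section General

variable (K : Type u) [Field K] {D : Type u} [CommRing D] [Algebra K D] (Δ : D) (d : ℕ)

/-- The extension of a prime `𝔪 ∌ Δ` of `D` to `D[1/Δ]` is prime. [folklore] -/
theorem isPrime_map_away_of_notMem (𝔪 : Ideal D) [𝔪.IsPrime] (hΔ : Δ ∉ 𝔪) :
    (𝔪.map (algebraMap D (Localization.Away Δ))).IsPrime :=
  IsLocalization.isPrime_of_isPrime_disjoint (Submonoid.powers Δ) _ 𝔪
    inferInstance ((Ideal.disjoint_powers_iff_notMem_of_isPrime (I := 𝔪) _).mpr hΔ)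

/-- For `Δ ∉ 𝔪` the local ring `(D[1/Δ])_{𝔪 D[1/Δ]}` is a localization of `D` at `𝔪` (so
`D_𝔪 ≅ (D[1/Δ])_{𝔪D[1/Δ]}`). [folklore] -/
theorem isLocalization_atPrime_of_notMem (𝔪 : Ideal D) [𝔪.IsPrime] (hΔ : Δ ∉ 𝔪) :
    haveI := isPrime_map_away_of_notMem Δ 𝔪 hΔ
    IsLocalization.AtPrime
      (Localization.AtPrime (𝔪.map (algebraMap D (Localization.Away Δ)))) 𝔪 := by
  haveI := isPrime_map_away_of_notMem Δ 𝔪 hΔ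
  have h := IsLocalization.isLocalization_isLocalization_atPrime_isLocalization
    (Submonoid.powers Δ) (Localization.AtPrime (𝔪.map (algebraMap D (Localization.Away Δ))))
    (𝔪.map (algebraMap D (Localization.Away Δ)))
  have hcomap : (𝔪.map (algebraMap D (Localization.Away Δ))).comap
      (algebraMap D (Localization.Away Δ)) = 𝔪 :=
    IsLocalization.under_map_of_isPrime_disjoint (Submonoid.powers Δ) _
      inferInstance ((Ideal.disjoint_powers_iff_notMem_of_isPrime (I := 𝔪) _).mpr hΔ)
  have hsub : 𝔪.primeCompl = ((𝔪.map (algebraMap D (Localization.Away Δ))).comap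
      (algebraMap D (Localization.Away Δ))).primeCompl := by
    ext x
    simp only [Ideal.primeCompl, Submonoid.mem_mk, Subsemigroup.mem_mk, Set.mem_compl_iff,
      SetLike.mem_coe, hcomap]
  change IsLocalization 𝔪.primeCompl _
  rw [hsub]
  exact h

variable [Algebra.IsStandardSmoothOfRelativeDimension d K (Localization.Away Δ)]

include K d in
/-- **`D_𝔪` is a regular local ring for `Δ ∉ 𝔪` when `D[1/Δ]` is standard smooth over the
field `K`** (GW Lemma 6.26: smooth points are regular). [cite: GortzWedhorn2020, Lemma 6.26 (p. 196)] -/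
theorem isRegularLocalRing_atPrime_of_notMem (𝔪 : Ideal D) [𝔪.IsPrime] (hΔ : Δ ∉ 𝔪) :
    IsRegularLocalRing (Localization.AtPrime 𝔪) := by
  haveI := isPrime_map_away_of_notMem Δ 𝔪 hΔ
  haveI : IsRegularLocalRing
      (Localization.AtPrime (𝔪.map (algebraMap D (Localization.Away Δ)))) :=
    Literature.AlgebraicGeometry.Motives.isRegularLocalRing_of_isStandardSmoothOfRelativeDimension
      K d (𝔪.map (algebraMap D (Localization.Away Δ)))
  haveI := isLocalization_atPrime_of_notMem Δ 𝔪 hΔ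
  exact IsRegularLocalRing.of_ringEquiv
    (IsLocalization.algEquiv 𝔪.primeCompl
      (Localization.AtPrime (𝔪.map (algebraMap D (Localization.Away Δ))))
      (Localization.AtPrime 𝔪)).toRingEquiv

include K d in
/-- **`dim D_𝔪 ≤ d` for `Δ ∉ 𝔪` when `D[1/Δ]` is standard smooth of relative dimension `d` over
the field `K`** (GW Lemma 6.26: "regular of dimension `≤ d`"; primes of `D[1/Δ]` have height
`≤ d`). [cite: GortzWedhorn2020, Lemma 6.26 (p. 196)] -/
theorem ringKrullDim_atPrime_le_of_notMem (𝔪 : Ideal D) [𝔪.IsPrime] (hΔ : Δ ∉ 𝔪) :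
    ringKrullDim (Localization.AtPrime 𝔪) ≤ (d : WithBot ℕ∞) := by
  haveI := isPrime_map_away_of_notMem Δ 𝔪 hΔ
  haveI := isLocalization_atPrime_of_notMem Δ 𝔪 hΔ
  rw [← ringKrullDim_eq_of_ringEquiv (IsLocalization.algEquiv 𝔪.primeCompl
      (Localization.AtPrime (𝔪.map (algebraMap D (Localization.Away Δ))))
      (Localization.AtPrime 𝔪)).toRingEquiv,
    IsLocalization.AtPrime.ringKrullDim_eq_height (𝔪.map (algebraMap D (Localization.Away Δ)))
      (Localization.AtPrime (𝔪.map (algebraMap D (Localization.Away Δ))))]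
  have h := Literature.AlgebraicGeometry.Dimension.height_le_of_isStandardSmoothOfRelativeDimension_of_isNoetherianRing
    (R := K) (S := Localization.Away Δ) d (𝔪.map (algebraMap D (Localization.Away Δ)))
  rwa [ringKrullDim_eq_zero_of_isField (Field.toIsField K), zero_add] at h

/-! ### The squeeze for an integral closed subscheme `Spec D/𝔞` of dimension `≥ d` -/

omit [Algebra.IsStandardSmoothOfRelativeDimension d K (Localization.Away Δ)] in
/-- The image `𝔪/𝔞` of a maximal ideal `𝔪 ⊇ 𝔞` is maximal (supplies the instance argument
`[(𝔪.map (Ideal.Quotient.mk 𝔞)).IsMaximal]` of the theorems below, which the type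
`Localization.AtPrime (𝔪/𝔞)` needs). [folklore] -/
theorem isMaximal_map_mk (𝔞 𝔪 : Ideal D) [𝔪.IsMaximal] (h𝔞𝔪 : 𝔞 ≤ 𝔪) :
    (𝔪.map (Ideal.Quotient.mk 𝔞)).IsMaximal := by
  refine (Ideal.map_eq_top_or_isMaximal_of_surjective _ Ideal.Quotient.mk_surjective
    inferInstance).resolve_left fun htop => ?_
  have h := Ideal.comap_map_of_surjective (Ideal.Quotient.mk 𝔞) Ideal.Quotient.mk_surjective 𝔪
  rw [htop, Ideal.comap_top, ← RingHom.ker_eq_comap_bot, Ideal.mk_ker, sup_eq_left.mpr h𝔞𝔪] at h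
  exact Ideal.IsMaximal.ne_top inferInstance h.symm

variable [Algebra.FiniteType K D] (𝔞 𝔪 : Ideal D) [𝔪.IsMaximal] [IsDomain (D ⧸ 𝔞)]
  [(𝔪.map (Ideal.Quotient.mk 𝔞)).IsMaximal]

include K d in
/-- **Hu 2025, §8.4 (the extra relations can be discarded near a smooth point): `𝔞 D_𝔪 = 0`.**
Let `D` be of finite type over the field `K` with `D[1/Δ]` standard smooth of relative dimension
`d`, `𝔞 ⊆ 𝔪` an ideal and a maximal ideal with `D/𝔞` a DOMAIN of dimension `≥ d`, and
`Δ ∉ 𝔪`. Then `𝔞` dies in `D_𝔪`: `Spec D/𝔞` and `Spec D` agree near `𝔪`. (In Hu's proof: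
`D` = chart ring modulo governing binomials and linearized Plücker relations, `Δ` = the maximal
minor `J*` of their Jacobian, `D/𝔞` = the coordinate ring of `Ṽ_ℓ ∩ 𝔙`, `d = dim Ṽ_ℓ`.)
[cite: Hu2025, §8.4, proof of Thm. 8.5] -/
theorem Ideal.map_atPrime_eq_bot_of_notMem (h𝔞𝔪 : 𝔞 ≤ 𝔪)
    (hdim : (d : WithBot ℕ∞) ≤ ringKrullDim (D ⧸ 𝔞)) (hΔ : Δ ∉ 𝔪) :
    𝔞.map (algebraMap D (Localization.AtPrime 𝔪)) = ⊥ := by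
  haveI := isRegularLocalRing_atPrime_of_notMem K Δ d 𝔪 hΔ
  haveI : IsDomain (Localization.AtPrime 𝔪) :=
    Literature.AlgebraicGeometry.Resolution.isDomain_of_isRegularLocalRing (Localization.AtPrime 𝔪)
  have hdimle := ringKrullDim_atPrime_le_of_notMem K Δ d 𝔪 hΔ
  haveI : FiniteRingKrullDim (Localization.AtPrime 𝔪) := by
    refine finiteRingKrullDim_iff_ne_bot_and_top.mpr ⟨fun hbot => ?_, fun htop => ?_⟩
    · have h0 := ringKrullDim_nonneg_of_nontrivial (R := Localization.AtPrime 𝔪)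
      rw [hbot] at h0
      exact WithBot.not_coe_le_bot _ h0
    · rw [htop, top_le_iff] at hdimle
      have h' : ((d : ℕ∞) : WithBot ℕ∞) = ((⊤ : ℕ∞) : WithBot ℕ∞) := hdimle
      exact ENat.coe_ne_top d (WithBot.coe_injective h')
  -- `(D/𝔞)_{𝔪/𝔞} ≅ D_𝔪 / 𝔞 D_𝔪` has dimension `dim D/𝔞 ≥ d ≥ dim D_𝔪`
  refine Ideal.eq_bot_of_ringKrullDim_le_quotient (R := Localization.AtPrime 𝔪) ?_
  rw [← ringKrullDim_eq_of_ringEquiv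
      (localizationQuotientEquiv (h𝔮J := Ideal.IsMaximal.isPrime ‹_›) 𝔞 𝔪 D h𝔞𝔪).toRingEquiv,
    Literature.AlgebraicGeometry.Resolution.ringKrullDim_localization_atPrime_eq_of_isMaximal K
      (𝔪.map (Ideal.Quotient.mk 𝔞))]
  exact hdimle.trans hdim

include K d in
/-- **Hu 2025, §8.4 ("`Ṽ_ℓ` is smooth at `z`"): `(D/𝔞)_{𝔪/𝔞}` is a regular local ring** under
the hypotheses of `Ideal.map_atPrime_eq_bot_of_notMem` — the Jacobian criterion for an integral
closed subscheme of the expected dimension. [cite: Hu2025, §8.4, proof of Thm. 8.5]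
[cite: GortzWedhorn2020, Lemma 6.26 (p. 196)] -/
theorem isRegularLocalRing_atPrime_quotient_of_notMem (h𝔞𝔪 : 𝔞 ≤ 𝔪)
    (hdim : (d : WithBot ℕ∞) ≤ ringKrullDim (D ⧸ 𝔞)) (hΔ : Δ ∉ 𝔪) :
    IsRegularLocalRing (Localization.AtPrime (𝔪.map (Ideal.Quotient.mk 𝔞))) := by
  haveI := isRegularLocalRing_atPrime_of_notMem K Δ d 𝔪 hΔ
  have hbot := Ideal.map_atPrime_eq_bot_of_notMem K Δ d 𝔞 𝔪 h𝔞𝔪 hdim hΔ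
  have e := (localizationQuotientEquiv (h𝔮J := Ideal.IsMaximal.isPrime ‹_›) 𝔞 𝔪 D
    h𝔞𝔪).toRingEquiv.trans
      ((Ideal.quotEquivOfEq hbot).trans (RingEquiv.quotientBot (Localization.AtPrime 𝔪)))
  exact IsRegularLocalRing.of_ringEquiv (R := Localization.AtPrime 𝔪) e.symm

include K Δ 𝔪 in
/-- **`dim D/𝔞 = d` exactly** under the hypotheses of `Ideal.map_atPrime_eq_bot_of_notMem`
(Hu: "`dim T_z(Ṽ_ℓ) = dim Ṽ_ℓ`"). [cite: Hu2025, §8.4, proof of Thm. 8.5] -/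
theorem ringKrullDim_quotient_eq_of_notMem (h𝔞𝔪 : 𝔞 ≤ 𝔪)
    (hdim : (d : WithBot ℕ∞) ≤ ringKrullDim (D ⧸ 𝔞)) (hΔ : Δ ∉ 𝔪) :
    ringKrullDim (D ⧸ 𝔞) = (d : WithBot ℕ∞) := by
  refine le_antisymm ?_ hdim
  have hbot := Ideal.map_atPrime_eq_bot_of_notMem K Δ d 𝔞 𝔪 h𝔞𝔪 hdim hΔ
  have e := (localizationQuotientEquiv (h𝔮J := Ideal.IsMaximal.isPrime ‹_›) 𝔞 𝔪 D
    h𝔞𝔪).toRingEquiv.trans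
      ((Ideal.quotEquivOfEq hbot).trans (RingEquiv.quotientBot (Localization.AtPrime 𝔪)))
  rw [← Literature.AlgebraicGeometry.Resolution.ringKrullDim_localization_atPrime_eq_of_isMaximal K
      (𝔪.map (Ideal.Quotient.mk 𝔞)), ringKrullDim_eq_of_ringEquiv e]
  exact ringKrullDim_atPrime_le_of_notMem K Δ d 𝔪 hΔ

/-! ### The same for a surjection `π : D ↠ B` onto a domain (no iterated quotients) -/

omit [𝔪.IsMaximal] [IsDomain (D ⧸ 𝔞)] [(𝔪.map (Ideal.Quotient.mk 𝔞)).IsMaximal] in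
include K d in
/-- **Surjection form of `Ideal.map_atPrime_eq_bot_of_notMem`**: for `π : D ↠ B` onto a domain
`B` of dimension `≥ d` and a maximal ideal `𝔫` of `B` with `π(Δ) ∉ 𝔫`, the kernel of `π` dies in
`D_{π⁻¹𝔫}`. [cite: Hu2025, §8.4, proof of Thm. 8.5] -/
theorem RingHom.ker_map_atPrime_eq_bot_of_notMem {B : Type u} [CommRing B] [IsDomain B]
    (π : D →+* B) (hπ : Function.Surjective π) (𝔫 : Ideal B) [𝔫.IsMaximal]
    (hdim : (d : WithBot ℕ∞) ≤ ringKrullDim B) (hΔ : π Δ ∉ 𝔫) :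
    haveI := Ideal.comap_isMaximal_of_surjective π hπ (K := 𝔫)
    (RingHom.ker π).map (algebraMap D (Localization.AtPrime (𝔫.comap π))) = ⊥ := by
  haveI := Ideal.comap_isMaximal_of_surjective π hπ (K := 𝔫)
  have hle : RingHom.ker π ≤ 𝔫.comap π := fun x hx => by
    rw [Ideal.mem_comap, RingHom.mem_ker.mp hx]
    exact 𝔫.zero_mem
  haveI := isMaximal_map_mk (RingHom.ker π) (𝔫.comap π) hle
  let e : (D ⧸ RingHom.ker π) ≃+* B := RingHom.quotientKerEquivOfSurjective hπ
  haveI : IsDomain (D ⧸ RingHom.ker π) := MulEquiv.isDomain B e.toMulEquiv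
  refine Ideal.map_atPrime_eq_bot_of_notMem K Δ d (RingHom.ker π) (𝔫.comap π) hle ?_ hΔ
  rwa [ringKrullDim_eq_of_ringEquiv e]

omit [𝔪.IsMaximal] [IsDomain (D ⧸ 𝔞)] [(𝔪.map (Ideal.Quotient.mk 𝔞)).IsMaximal] in
include K Δ d in
/-- **Surjection form of `ringKrullDim_quotient_eq_of_notMem`**: `dim B = d`.
[cite: Hu2025, §8.4, proof of Thm. 8.5] -/
theorem ringKrullDim_eq_of_surjective_of_notMem {B : Type u} [CommRing B] [IsDomain B]
    (π : D →+* B) (hπ : Function.Surjective π) (𝔫 : Ideal B) [𝔫.IsMaximal]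
    (hdim : (d : WithBot ℕ∞) ≤ ringKrullDim B) (hΔ : π Δ ∉ 𝔫) :
    ringKrullDim B = (d : WithBot ℕ∞) := by
  haveI := Ideal.comap_isMaximal_of_surjective π hπ (K := 𝔫)
  have hle : RingHom.ker π ≤ 𝔫.comap π := fun x hx => by
    rw [Ideal.mem_comap, RingHom.mem_ker.mp hx]
    exact 𝔫.zero_mem
  haveI := isMaximal_map_mk (RingHom.ker π) (𝔫.comap π) hle
  let e : (D ⧸ RingHom.ker π) ≃+* B := RingHom.quotientKerEquivOfSurjective hπ
  haveI : IsDomain (D ⧸ RingHom.ker π) := MulEquiv.isDomain B e.toMulEquiv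
  rw [← ringKrullDim_eq_of_ringEquiv e] at hdim ⊢
  exact ringKrullDim_quotient_eq_of_notMem K Δ d (RingHom.ker π) (𝔫.comap π) hle hdim hΔ

omit [𝔪.IsMaximal] [IsDomain (D ⧸ 𝔞)] [(𝔪.map (Ideal.Quotient.mk 𝔞)).IsMaximal] in
include K Δ d in
/-- **Surjection form of `isRegularLocalRing_atPrime_quotient_of_notMem`**: `B_𝔫` is a regular
local ring — the Jacobian criterion for an integral closed subscheme `Spec B ↪ Spec D` of the
expected dimension at a point where `Δ` is invertible. [cite: Hu2025, §8.4, proof of Thm. 8.5]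
[cite: GortzWedhorn2020, Lemma 6.26 (p. 196)] -/
theorem isRegularLocalRing_atPrime_of_surjective_of_notMem {B : Type u} [CommRing B] [IsDomain B]
    (π : D →+* B) (hπ : Function.Surjective π) (𝔫 : Ideal B) [𝔫.IsMaximal]
    (hdim : (d : WithBot ℕ∞) ≤ ringKrullDim B) (hΔ : π Δ ∉ 𝔫) :
    IsRegularLocalRing (Localization.AtPrime 𝔫) := by
  haveI := Ideal.comap_isMaximal_of_surjective π hπ (K := 𝔫)
  have hle : RingHom.ker π ≤ 𝔫.comap π := fun x hx => by
    rw [Ideal.mem_comap, RingHom.mem_ker.mp hx]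
    exact 𝔫.zero_mem
  haveI := isMaximal_map_mk (RingHom.ker π) (𝔫.comap π) hle
  let e : (D ⧸ RingHom.ker π) ≃+* B := RingHom.quotientKerEquivOfSurjective hπ
  haveI : IsDomain (D ⧸ RingHom.ker π) := MulEquiv.isDomain B e.toMulEquiv
  have hdim' : (d : WithBot ℕ∞) ≤ ringKrullDim (D ⧸ RingHom.ker π) := by
    rwa [ringKrullDim_eq_of_ringEquiv e]
  haveI hreg := isRegularLocalRing_atPrime_quotient_of_notMem K Δ d (RingHom.ker π) (𝔫.comap π)
    hle hdim' hΔ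
  -- transport along `e`: `𝔫.comap e = (𝔫.comap π)/ker π` as ideals of `D / ker π`
  have hideal : 𝔫.comap e = (𝔫.comap π).map (Ideal.Quotient.mk (RingHom.ker π)) := by
    apply le_antisymm
    · intro x hx
      obtain ⟨y, rfl⟩ := Ideal.Quotient.mk_surjective x
      exact Ideal.mem_map_of_mem _ (show y ∈ 𝔫.comap π from hx)
    · rw [Ideal.map_le_iff_le_comap]
      intro y hy
      exact hy
  have hsub : ((𝔫.comap π).map (Ideal.Quotient.mk (RingHom.ker π))).primeCompl =
      (𝔫.comap e).primeCompl := by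
    ext x
    simp only [Ideal.primeCompl, Submonoid.mem_mk, Subsemigroup.mem_mk, Set.mem_compl_iff,
      SetLike.mem_coe, hideal]
  haveI : IsLocalization.AtPrime
      (Localization.AtPrime ((𝔫.comap π).map (Ideal.Quotient.mk (RingHom.ker π))))
      (𝔫.comap e) := by
    change IsLocalization (𝔫.comap e).primeCompl _
    rw [← hsub]
    exact Localization.isLocalization
  exact IsRegularLocalRing.of_ringEquiv
    (R := Localization.AtPrime ((𝔫.comap π).map (Ideal.Quotient.mk (RingHom.ker π))))
    (IsLocalization.ringEquivOfRingEquiv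
      (Localization.AtPrime ((𝔫.comap π).map (Ideal.Quotient.mk (RingHom.ker π))))
      (Localization.AtPrime 𝔫) e (e.map_primeCompl_comap_eq 𝔫))

end General

/-! ### The case `D = K[T₁,…,Tₙ]/(f₁,…,f_c)`, `Δ` a `c × c` Jacobian minor -/

section Jacobian

variable (K : Type u) [Field K] {n c : ℕ} (f : Fin c → MvPolynomial (Fin n) K)
  (a : Fin c → Fin n) (ha : Function.Injective a)

/-- **`D_𝔪` is regular for `Δ ∉ 𝔪`**, `D = K[T₁,…,Tₙ]/(f₁,…,f_c)`, `Δ = det (∂f_j/∂T_{a i})`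
(`JacobianCriterion.isStandardSmoothOfRelativeDimension_away`: `D[1/Δ]` is standard smooth of
relative dimension `n - c`). [cite: GortzWedhorn2020, Def. 6.14 (p. 159), Lemma 6.26 (p. 196)] -/
theorem isRegularLocalRing_atPrime_of_jacobianMinor_notMem (𝔪 : Ideal (Quot f)) [𝔪.IsPrime]
    (hΔ : jacobianMinor f a ha ∉ 𝔪) : IsRegularLocalRing (Localization.AtPrime 𝔪) :=
  haveI := isStandardSmoothOfRelativeDimension_away f a ha
    (Localization.Away (jacobianMinor f a ha))
  isRegularLocalRing_atPrime_of_notMem K (jacobianMinor f a ha) (n - c) 𝔪 hΔ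

/-- **`dim D_𝔪 ≤ n - c` for `Δ ∉ 𝔪`**, `D = K[T₁,…,Tₙ]/(f₁,…,f_c)`.
[cite: GortzWedhorn2020, Lemma 6.26 (p. 196)] -/
theorem ringKrullDim_atPrime_le_of_jacobianMinor_notMem (𝔪 : Ideal (Quot f)) [𝔪.IsPrime]
    (hΔ : jacobianMinor f a ha ∉ 𝔪) :
    ringKrullDim (Localization.AtPrime 𝔪) ≤ ((n - c : ℕ) : WithBot ℕ∞) :=
  haveI := isStandardSmoothOfRelativeDimension_away f a ha
    (Localization.Away (jacobianMinor f a ha))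
  ringKrullDim_atPrime_le_of_notMem K (jacobianMinor f a ha) (n - c) 𝔪 hΔ

variable {B : Type u} [CommRing B] [IsDomain B] (π : Quot f →+* B) (hπ : Function.Surjective π)
  (𝔫 : Ideal B) [𝔫.IsMaximal]

include hπ in
/-- **Hu 2025, §8.4: the extra relations die near a point where the Jacobian minor is
invertible.** For `D = K[T₁,…,Tₙ]/(f₁,…,f_c)`, a surjection `π : D ↠ B` onto a domain of dimension
`≥ n - c` (the coordinate ring of an integral closed subscheme of `Spec D` of the expected
dimension, e.g. Hu's `Ṽ_ℓ ∩ 𝔙` inside the locus of the governing binomials and linearized Plücker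
relations) and a maximal ideal `𝔫` of `B` not containing the image of a `c × c` Jacobian minor:
`ker π` dies in `D_{π⁻¹𝔫}` ("the relations of `𝓑^𝔯𝔟` must lie in the ideal generated by `𝓑^gov`
and `L_𝓕`, thus can be discarded"). [cite: Hu2025, §8.4, proof of Thm. 8.5] -/
theorem RingHom.ker_map_atPrime_eq_bot_of_jacobianMinor_notMem
    (hdim : ((n - c : ℕ) : WithBot ℕ∞) ≤ ringKrullDim B) (hΔ : π (jacobianMinor f a ha) ∉ 𝔫) :
    haveI := Ideal.comap_isMaximal_of_surjective π hπ (K := 𝔫)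
    (RingHom.ker π).map (algebraMap (Quot f) (Localization.AtPrime (𝔫.comap π))) = ⊥ :=
  haveI := isStandardSmoothOfRelativeDimension_away f a ha
    (Localization.Away (jacobianMinor f a ha))
  RingHom.ker_map_atPrime_eq_bot_of_notMem K (jacobianMinor f a ha) (n - c) π hπ 𝔫 hdim hΔ

include hπ in
/-- **Hu 2025, Thm. 8.5 via §8.4 ("`Z̃` is smooth at `z`"): `B_𝔫` is a regular local ring** under
the hypotheses of `RingHom.ker_map_atPrime_eq_bot_of_jacobianMinor_notMem` — the Jacobian
criterion for an integral closed subscheme of the expected dimension `n - c` of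
`Spec K[T₁,…,Tₙ]/(f₁,…,f_c)`. [cite: Hu2025, §8.4, proof of Thm. 8.5]
[cite: GortzWedhorn2020, Lemma 6.26 (p. 196)] -/
theorem isRegularLocalRing_atPrime_of_surjective_of_jacobianMinor_notMem
    (hdim : ((n - c : ℕ) : WithBot ℕ∞) ≤ ringKrullDim B) (hΔ : π (jacobianMinor f a ha) ∉ 𝔫) :
    IsRegularLocalRing (Localization.AtPrime 𝔫) :=
  haveI := isStandardSmoothOfRelativeDimension_away f a ha
    (Localization.Away (jacobianMinor f a ha))
  isRegularLocalRing_atPrime_of_surjective_of_notMem K (jacobianMinor f a ha) (n - c) π hπ 𝔫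
    hdim hΔ

include hπ in
/-- **`dim B = n - c` exactly** under the hypotheses of
`RingHom.ker_map_atPrime_eq_bot_of_jacobianMinor_notMem` (Hu: "`dim T_z(Ṽ_ℓ) = dim Ṽ_ℓ`").
[cite: Hu2025, §8.4, proof of Thm. 8.5] -/
theorem ringKrullDim_eq_of_surjective_of_jacobianMinor_notMem
    (hdim : ((n - c : ℕ) : WithBot ℕ∞) ≤ ringKrullDim B) (hΔ : π (jacobianMinor f a ha) ∉ 𝔫) :
    ringKrullDim B = ((n - c : ℕ) : WithBot ℕ∞) :=
  haveI := isStandardSmoothOfRelativeDimension_away f a ha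
    (Localization.Away (jacobianMinor f a ha))
  ringKrullDim_eq_of_surjective_of_notMem K (jacobianMinor f a ha) (n - c) π hπ 𝔫 hdim hΔ

end Jacobian

end Literature.AlgebraicGeometry.Smoothening

end
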